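import Summits.Parity.GeneralizedHardyLittlewood.Theorems.LZZCertificateReplayLightRows
import Summits.Parity.GeneralizedHardyLittlewood.Theorems.LZZCertificateReplayHeavyRows
import Summits.Parity.GeneralizedHardyLittlewood.Theorems.LZZCertificateReplayReplayedCertificatesGlue
import Summits.Parity.GeneralizedHardyLittlewood.Theorems.LZZCertificateReplayAssembly
import Literature.NumberTheory.LFunctions.RealCharacterLadderLeaves

/-!
# Route `LZZCertificateReplay` — the rung leaf modulo the printed Theorem 2.1

With `LightRows` (`lightRows_holds`, 354 kernel-certified windows, 171 068 rows) and `HeavyRows`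
(`heavyRows_holds`, 1 735 kernel-certified heavy files, 72 039 rows) both proved, the route's crux
`ReplayedCertificates` (`theorem21 → NoExceptionalZeroUpTo 400000 (1/5)`) is a THEOREM, and the rung leaf
`Literature.NumberTheory.LFunctions.NoExceptionalZeroUpTo_4e5_fifth` holds CONDITIONALLY on the one remaining
named fact `Literature.NumberTheory.LFunctions.LuZamanZhao2026.theorem21` (Lu–Zaman–Zhao, Math. Comp. 2026,
Theorem 2.1 as printed; route item `Theorem21`, open). This file records exactly these two statements for
consumers; nothing is computed here. WHAT THIS IS NOT: not an unconditional proof of the leaf — its trust base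
is `theorem21`.
-/

namespace Summit.Parity.GeneralizedHardyLittlewood.Theorems

open Summit.Parity.GeneralizedHardyLittlewood.Theses

/-- **`ReplayedCertificates` holds**: assuming Lu–Zaman–Zhao's Theorem 2.1 as printed, no primitive quadratic
character of modulus `3 ≤ q ≤ 4·10⁵` has a real zero in `(0,1] ∩ [1 − 1/(5 log q), 1]` — the kernel replay of
all 243 107 Table-1 certificates (`λ = 1.6`), light and heavy, through the W-3 split glue. -/
theorem replayedCertificates_holds : LZZCertificateReplay.ReplayedCertificates :=
  replayedCertificatesGlue_holds lightRows_holds heavyRows_holds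

/-- **The rung leaf modulo the printed fact**: `theorem21 → NoExceptionalZeroUpTo_4e5_fifth`
(`= NoExceptionalZeroUpTo 400000 (1/5)`), by the route's assembly applied to `replayedCertificates_holds`.
CONDITIONAL: trust base `LuZamanZhao2026.theorem21`. -/
theorem noExceptionalZeroUpTo_4e5_fifth_of_theorem21
    (h21 : Literature.NumberTheory.LFunctions.LuZamanZhao2026.theorem21) :
    Literature.NumberTheory.LFunctions.NoExceptionalZeroUpTo_4e5_fifth :=
  lzzCertificateReplay_assembly_proof replayedCertificates_holds h21

end Summit.Parity.GeneralizedHardyLittlewood.Theorems
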